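import Literature.Analysis.FluidPDE.QuasiSelfSimilarFamilyEstimates
import Literature.Analysis.FluidPDE.QuasiSelfSimilarPlanar
import Literature.Analysis.FunctionSpaces.TorusPeriodizationCube
import HarnessLib

/-!
# The planar family of Bruè–De Lellis 2023, Thm. 4.1 from the building blocks (proofs)

Topic `Literature/Analysis/FluidPDE`; proofs file for `QuasiSelfSimilarPlanar.lean`
(`Literature.Analysis.FluidPDE.alberti_crippa_mazzucato_planar_family`, Bruè–De Lellis, CMP 400
(2023), Thm. 4.1 in its native planar setting: `C^∞` fields on `[0,1] × ℝ²` supported per level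
in compacts `K_n ⋐ (0,1)²`, transport + incompressibility, the integer-order bounds (a) and
(4.9)–(4.10), item (b) with zero averages on the cells of `𝒬(2·5ⁿ)`, handover (d)).

Main result: `alberti_crippa_mazzucato_planar_family_of_acm_building_blocks` — the planar
family follows from the accepted structural fact `acm_building_blocks`
(`QuasiSelfSimilarBuildingBlocks.lean`: finitely many building blocks `(V_i, Θ_i)` with
BDL §4.1 (i)–(iv), and labels `ι n` for which the patched fields (4.3)–(4.4) on `T²`,
`QuasiSelfSimilar.scalar`, `QuasiSelfSimilar.velocity`, are jointly smooth, vanish outside a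
compact `K_n` of the open fundamental square and hand over). The planar witnesses are the
**cube cut-offs** of the torus fields (`𝟙_{[0,1)²} · (u ∘ proj)`, in Lean
`(unitCube (Fin 2)).indicator (lift u)`): the periodic lift restricted to the fundamental
square `[0,1)²` and extended by zero — which is BDL's `ρ_n`, `v_n` on `[0,1]²`
(4.3)–(4.4) extended by zero, the object whose `1`-periodisation BDL §5 then puts back on `T²`.
Since the torus fields vanish on `[0,1)² ∖ K_n`, the cut-off is the (smooth) lift near the open
square and zero near the complement of `K_n`, so every planar clause is either read off the
torus family — transport and incompressibility (`QuasiSelfSimilar.isClassicalScalarTransportOn`),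
`∫ρ_n = 0`, `∫ρ_n² = 1`, `|ρ_n| ≤ 10`, `‖∇ρ_n‖ ≤ C 5ⁿ`, the vanishing cell averages
(`QuasiSelfSimilarFamilyEstimates.lean`) — or is the scaling analysis of ACM 2019, Lemma 18 for
sup norms: `‖Dʲ ∂ₜᵏ v_n‖_∞`, `‖Dʲ ∂ₜᵏ (v_n·∇v_n)‖_∞ ≤ C 2^{j-1} 5^{(j-1)n}`, from
`Torus.norm_iteratedFDeriv_lift_patchTorus_le` (the time derivatives act blockwise, the
convective term of the patched velocity is the `mₙ⁻¹`-patch of `DV_i[V_i]`, BDL (4.9), and the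
block derivatives are bounded on the compact `[0,1] × [0,1]²`).

With `alberti_crippa_mazzucato_family_of_planar` (`QuasiSelfSimilarMixingProofs.lean`) this also
re-derives the torus family; the direct torus route is `QuasiSelfSimilarFamilyEstimates.lean`.

## References

* E. Bruè, C. De Lellis, *Anomalous dissipation for the forced 3D Navier–Stokes equations*,
  Comm. Math. Phys. 400 (2023), Thm. 4.1, (4.3)–(4.4), (4.9)–(4.10), §5 first paragraph
  (arXiv:2207.06301, pp. 9–10).
* G. Alberti, G. Crippa, A. L. Mazzucato, *Exponential self-similar mixing by incompressible
  flows*, J. Amer. Math. Soc. 32 (2019), §6.2, Lemma 18 (arXiv:1605.02090).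
-/

noncomputable section

open MeasureTheory Set Filter Function Metric
open scoped Topology NNReal ContDiff InnerProductSpace

namespace Literature.Analysis.FluidPDE

namespace QuasiSelfSimilar

open FunctionSpaces FunctionSpaces.Torus

/-! ## Calculus: mixed derivatives of fields smooth on `[0,1] × E` -/

section Calculus

variable {E : Type*} [NormedAddCommGroup E] [NormedSpace ℝ E]
  {F : Type*} [NormedAddCommGroup F] [NormedSpace ℝ F]

/-- **Space derivatives of all orders of a smooth field are smooth on the time set**: for `G`
of class `C^∞` on `S ×ˢ univ`, `(t, y) ↦ D_yʲ(G(t, ·))(y)` is `C^∞` on `S ×ˢ univ` for every `j`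
(induction on `j` with `ContDiffOn.contDiffOn_fderiv_slice`). [folklore] -/
theorem _root_.ContDiffOn.contDiffOn_iteratedFDeriv_slice {G : ℝ × E → F} {S : Set ℝ}
    (hG : ContDiffOn ℝ ∞ G (S ×ˢ univ)) (hS : UniqueDiffOn ℝ S) (j : ℕ) :
    ContDiffOn ℝ ∞ (fun p : ℝ × E => iteratedFDeriv ℝ j (fun z => G (p.1, z)) p.2) (S ×ˢ univ) := by
  induction j with
  | zero =>
    simp only [iteratedFDeriv_zero_eq_comp]
    exact (continuousMultilinearCurryFin0 ℝ E F).symm.contDiff.comp_contDiffOn hG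
  | succ j ih =>
    simp only [iteratedFDeriv_succ_eq_comp_left]
    exact (continuousMultilinearCurryLeftEquiv ℝ (fun _ : Fin (j + 1) => E) F).symm.contDiff
      |>.comp_contDiffOn (ih.contDiffOn_fderiv_slice hS)

/-- **Uniform bounds of mixed derivatives on `[0,1] ×` a compact set.** For `B` of class `C^∞`
on `[0,1] × E`, a compact `K ⊆ E` and orders `j, k`, the space derivatives
`D_wʲ (∂ₜᵏ|_{[0,1]} B(·, w)(t))` are bounded on `[0,1] × K`. [folklore] -/
theorem exists_bound_iteratedFDeriv_iteratedDerivWithin {B : ℝ → E → F}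
    (hB : ContDiffOn ℝ ∞ (fun p : ℝ × E => B p.1 p.2) (Icc 0 1 ×ˢ univ)) {K : Set E}
    (hK : IsCompact K) (j k : ℕ) :
    ∃ C : ℝ, 0 ≤ C ∧ ∀ t ∈ Icc (0 : ℝ) 1, ∀ w ∈ K,
      ‖iteratedFDeriv ℝ j (fun z => iteratedDerivWithin k (fun s => B s z) (Icc 0 1) t) w‖ ≤ C := by
  have hS : UniqueDiffOn ℝ (Icc (0 : ℝ) 1) := uniqueDiffOn_Icc zero_lt_one
  have h1 : ContDiffOn ℝ ∞
      (fun p : ℝ × E => iteratedDerivWithin k (fun s => B s p.2) (Icc 0 1) p.1) (Icc 0 1 ×ˢ univ) :=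
    hB.iteratedDerivWithin_slice hS k
  have h2 := (h1.contDiffOn_iteratedFDeriv_slice hS j).continuousOn
  obtain ⟨C, hC⟩ := (isCompact_Icc.prod hK).exists_bound_of_continuousOn (h2.mono
    (prod_mono Subset.rfl (subset_univ _)))
  refine ⟨max C 0, le_max_right _ _, fun t ht w hw => ?_⟩
  exact (hC (t, w) ⟨ht, hw⟩).trans (le_max_left _ _)

/-- A mixed derivative of a field vanishing near `y` for all `s ∈ [0,1]` vanishes at `y`.
[folklore] -/
theorem iteratedFDeriv_iteratedDerivWithin_eq_zero_of_local {j k : ℕ} {G : ℝ → E → F} {y : E}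
    (hG : ∀ᶠ z in 𝓝 y, ∀ s ∈ Icc (0 : ℝ) 1, G s z = 0) {t : ℝ} (ht : t ∈ Icc (0 : ℝ) 1) :
    iteratedFDeriv ℝ j (fun z => iteratedDerivWithin k (fun s => G s z) (Icc 0 1) t) y = 0 := by
  have hev : (fun z => iteratedDerivWithin k (fun s => G s z) (Icc 0 1) t) =ᶠ[𝓝 y]
      fun _ => (0 : F) := by
    filter_upwards [hG] with z hz
    rw [iteratedDerivWithin_congr (f := fun s => G s z) (g := fun _ => (0 : F))
      (fun s hs => hz s hs) ht]
    exact iteratedDerivWithin_fun_const_zero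
  rw [(hev.iteratedFDeriv ℝ j).self_of_nhds]
  simp

end Calculus

/-! ## The cube cut-off `𝟙_{[0,1)²} (u ∘ proj)` of a torus field -/

section CubeCut

variable {F : Type*}

variable [Zero F]

/-- On the fundamental square the cut-off is the torus field read at `proj y`. [folklore] -/
theorem cutoff_apply_of_mem (u : UnitAddTorus (Fin 2) → F) {y : EuclideanSpace ℝ (Fin 2)}
    (hy : y ∈ unitCube (Fin 2)) : (unitCube (Fin 2)).indicator (lift u) y = u (proj y) := by
  rw [indicator_of_mem hy, lift_apply]

/-- Off the fundamental square the cut-off vanishes. [folklore] -/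
theorem cutoff_apply_of_not_mem (u : UnitAddTorus (Fin 2) → F) {y : EuclideanSpace ℝ (Fin 2)}
    (hy : y ∉ unitCube (Fin 2)) : (unitCube (Fin 2)).indicator (lift u) y = 0 := by
  rw [indicator_of_notMem hy]

/-- The open square is open. [folklore] -/
theorem isOpen_openSquare : IsOpen openSquare := by
  have : openSquare = ⋂ k, (fun z : EuclideanSpace ℝ (Fin 2) => z k) ⁻¹' Ioo (0 : ℝ) 1 := by
    ext z; simp [openSquare]
  rw [this]
  exact isOpen_iInter_of_finite fun k => isOpen_Ioo.preimage (by fun_prop)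

/-- The open square lies in the fundamental square. [folklore] -/
theorem openSquare_subset_unitCube : openSquare ⊆ unitCube (Fin 2) :=
  fun _ hz k => Ioo_subset_Ico_self (hz k)

/-- **Germ on the open square**: around a point of the open square the cut-off is the periodic
lift. [folklore] -/
theorem cutoff_eventuallyEq_lift (u : UnitAddTorus (Fin 2) → F) {y : EuclideanSpace ℝ (Fin 2)}
    (hy : y ∈ openSquare) : (unitCube (Fin 2)).indicator (lift u) =ᶠ[𝓝 y] lift u :=
  eventuallyEq_of_mem (isOpen_openSquare.mem_nhds hy) fun z hz => by
    rw [cutoff_apply_of_mem u (openSquare_subset_unitCube hz), lift_apply]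

/-- If the torus field vanishes at `proj y` for `y ∈ [0,1)² ∖ K`, its cut-off vanishes off `K`.
[folklore] -/
theorem cutoff_eq_zero_of_not_mem {u : UnitAddTorus (Fin 2) → F} {K : Set (EuclideanSpace ℝ (Fin 2))}
    (hK : ∀ y ∈ unitCube (Fin 2), y ∉ K → u (proj y) = 0) {y : EuclideanSpace ℝ (Fin 2)}
    (hy : y ∉ K) : (unitCube (Fin 2)).indicator (lift u) y = 0 := by
  by_cases h : y ∈ unitCube (Fin 2)
  · rw [cutoff_apply_of_mem u h]; exact hK y h hy
  · exact cutoff_apply_of_not_mem u h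

/-- **Germ off `K`** (time-dependent form): if `u t` vanishes at `proj y` for `t ∈ [0,1]` and
`y ∈ [0,1)² ∖ K`, `K` closed, then around a point outside `K` the cut-offs of the `u t`,
`t ∈ [0,1]`, vanish identically. [folklore] -/
theorem eventually_cutoff_eq_zero {u : ℝ → UnitAddTorus (Fin 2) → F}
    {K : Set (EuclideanSpace ℝ (Fin 2))} (hKc : IsClosed K)
    (hK : ∀ t ∈ Icc (0 : ℝ) 1, ∀ y ∈ unitCube (Fin 2), y ∉ K → u t (proj y) = 0)
    {y : EuclideanSpace ℝ (Fin 2)} (hy : y ∉ K) :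
    ∀ᶠ z in 𝓝 y, ∀ t ∈ Icc (0 : ℝ) 1, (unitCube (Fin 2)).indicator (lift (u t)) z = 0 :=
  eventually_of_mem (hKc.isOpen_compl.mem_nhds hy) fun _ hz t ht =>
    cutoff_eq_zero_of_not_mem (hK t ht) hz

/-- **Germ on the open square** (time-dependent form). [folklore] -/
theorem eventually_cutoff_eq_lift (u : ℝ → UnitAddTorus (Fin 2) → F)
    {y : EuclideanSpace ℝ (Fin 2)} (hy : y ∈ openSquare) :
    ∀ᶠ z in 𝓝 y, ∀ t, (unitCube (Fin 2)).indicator (lift (u t)) z = lift (u t) z :=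
  eventually_of_mem (isOpen_openSquare.mem_nhds hy) fun z hz t => by
    rw [cutoff_apply_of_mem _ (openSquare_subset_unitCube hz), lift_apply]

end CubeCut

/-! ## Smoothness, transport and incompressibility of the cut-off family -/

section Transfer

variable {F : Type*} [NormedAddCommGroup F] [NormedSpace ℝ F]

/-- **Smoothness of the cut-off.** A jointly smooth torus field on `[0,1] × T²` whose slices
vanish on `[0,1)² ∖ K`, `K` closed in the open square, has a cut-off of class `C^∞` on
`[0,1] × ℝ²` (near the open square it is the space–time lift, near the complement of `K` it is
zero). [folklore] -/
theorem contDiffOn_cutoff {u : ℝ → UnitAddTorus (Fin 2) → F}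
    (hu : IsSmoothSpaceTimeOn (Icc 0 1) u) {K : Set (EuclideanSpace ℝ (Fin 2))}
    (hKc : IsClosed K) (hKsub : K ⊆ openSquare)
    (hK : ∀ t ∈ Icc (0 : ℝ) 1, ∀ y ∈ unitCube (Fin 2), y ∉ K → u t (proj y) = 0) :
    ContDiffOn ℝ ∞
      (fun p : ℝ × EuclideanSpace ℝ (Fin 2) => (unitCube (Fin 2)).indicator (lift (u p.1)) p.2)
      (Icc 0 1 ×ˢ univ) := by
  intro p hp
  by_cases hy : p.2 ∈ openSquare
  · have h1 : ∀ᶠ q : ℝ × EuclideanSpace ℝ (Fin 2) in 𝓝[Icc 0 1 ×ˢ univ] p, q.2 ∈ openSquare :=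
      (continuous_snd.continuousWithinAt (s := Icc (0 : ℝ) 1 ×ˢ univ) (x := p)).tendsto.eventually
        (isOpen_openSquare.mem_nhds hy)
    refine (hu p hp).congr_of_eventuallyEq (h1.mono fun q hq => ?_) ?_
    · exact cutoff_apply_of_mem _ (openSquare_subset_unitCube hq)
    · exact cutoff_apply_of_mem _ (openSquare_subset_unitCube hy)
  · have hyK : p.2 ∉ K := fun h => hy (hKsub h)
    have h1 : ∀ᶠ q : ℝ × EuclideanSpace ℝ (Fin 2) in 𝓝[Icc 0 1 ×ˢ univ] p,
        q.2 ∈ Kᶜ ∧ q ∈ Icc (0 : ℝ) 1 ×ˢ univ :=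
      ((continuous_snd.continuousWithinAt (s := Icc (0 : ℝ) 1 ×ˢ univ) (x := p)).tendsto.eventually
        (hKc.isOpen_compl.mem_nhds hyK)).and self_mem_nhdsWithin
    refine (contDiffWithinAt_const (c := (0 : F))).congr_of_eventuallyEq
      (h1.mono fun q hq => ?_) ?_
    · exact cutoff_eq_zero_of_not_mem (hK q.1 hq.2.1) hq.1
    · exact cutoff_eq_zero_of_not_mem (hK p.1 hp.1) hyK

variable {N : ℕ} {V : Fin N → ℝ → EuclideanSpace ℝ (Fin 2) → EuclideanSpace ℝ (Fin 2)}
  {Θ : Fin N → ℝ → EuclideanSpace ℝ (Fin 2) → ℝ} {ι : ℕ → (Fin 2 → ℤ) → Fin N}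

/-- **Transport for the cut-off family**: `∂ₜρ_n + v_n·∇ρ_n = 0` on `[0,1] × ℝ²` for the
cut-offs of a classical torus solution vanishing on `[0,1)² ∖ K`, `K` closed in the open square
(near `K`: the torus equation at `proj y`, with `∇(lift θ)(y) = ∇θ(proj y)`; off `K`: all terms
vanish). [cite: BrueDeLellisCMP2023, Thm. 4.1] -/
theorem transport_cutoff {u : ℝ → UnitAddTorus (Fin 2) → EuclideanSpace ℝ (Fin 2)}
    {θ : ℝ → UnitAddTorus (Fin 2) → ℝ}
    (hsol : Torus.IsClassicalScalarTransportOn (Icc 0 1) 0 u θ)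
    {K : Set (EuclideanSpace ℝ (Fin 2))} (hKc : IsClosed K) (hKsub : K ⊆ openSquare)
    (hK : ∀ t ∈ Icc (0 : ℝ) 1, ∀ y ∈ unitCube (Fin 2), y ∉ K → θ t (proj y) = 0)
    {t : ℝ} (ht : t ∈ Icc (0 : ℝ) 1) (y : EuclideanSpace ℝ (Fin 2)) :
    derivWithin (fun s => (unitCube (Fin 2)).indicator (lift (θ s)) y) (Icc 0 1) t +
      ⟪(unitCube (Fin 2)).indicator (lift (u t)) y,
        gradient ((unitCube (Fin 2)).indicator (lift (θ t))) y⟫_ℝ = 0 := by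
  by_cases hyK : y ∈ K
  · have hy : y ∈ openSquare := hKsub hyK
    have hyc : y ∈ unitCube (Fin 2) := openSquare_subset_unitCube hy
    have h1 : (fun s => (unitCube (Fin 2)).indicator (lift (θ s)) y) = fun s => θ s (proj y) :=
      funext fun s => cutoff_apply_of_mem _ hyc
    have h2 : gradient ((unitCube (Fin 2)).indicator (lift (θ t))) y = Torus.gradient (θ t) (proj y) := by
      rw [(cutoff_eventuallyEq_lift (θ t) hy).gradient_eq, gradient_lift]
    rw [h1, h2, cutoff_apply_of_mem _ hyc]
    have h := hsol.transport t ht (proj y)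
    rw [zero_mul] at h
    exact h
  · have hev : ∀ᶠ z in 𝓝 y, ∀ s ∈ Icc (0 : ℝ) 1, (unitCube (Fin 2)).indicator (lift (θ s)) z = 0 :=
      eventually_cutoff_eq_zero hKc hK hyK
    have h1 : derivWithin (fun s => (unitCube (Fin 2)).indicator (lift (θ s)) y) (Icc 0 1) t = 0 := by
      rw [derivWithin_congr (f := fun _ => (0 : ℝ)) (fun s hs => (hev.self_of_nhds) s hs)
        (hev.self_of_nhds t ht)]
      simp
    have h2 : gradient ((unitCube (Fin 2)).indicator (lift (θ t))) y = 0 := by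
      have hev' : (unitCube (Fin 2)).indicator (lift (θ t)) =ᶠ[𝓝 y] fun _ => (0 : ℝ) :=
        hev.mono fun z hz => hz t ht
      rw [hev'.gradient_eq]
      simp
    rw [h1, h2, inner_zero_right, add_zero]

/-- **Incompressibility of the cut-off velocity**: `tr D(v_n(t,·))(y) = 0` on `ℝ²` (near `K`:
`D(lift u)(y)` is the torus derivative, whose trace is `div u(t)(proj y) = 0`; off `K` the field
vanishes). [cite: BrueDeLellisCMP2023, Thm. 4.1 (a)] -/
theorem trace_fderiv_cutoff {u : ℝ → UnitAddTorus (Fin 2) → EuclideanSpace ℝ (Fin 2)}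
    {θ : ℝ → UnitAddTorus (Fin 2) → ℝ}
    (hsol : Torus.IsClassicalScalarTransportOn (Icc 0 1) 0 u θ)
    {K : Set (EuclideanSpace ℝ (Fin 2))} (hKc : IsClosed K) (hKsub : K ⊆ openSquare)
    (hK : ∀ t ∈ Icc (0 : ℝ) 1, ∀ y ∈ unitCube (Fin 2), y ∉ K → u t (proj y) = 0)
    {t : ℝ} (ht : t ∈ Icc (0 : ℝ) 1) (y : EuclideanSpace ℝ (Fin 2)) :
    LinearMap.trace ℝ _
      (fderiv ℝ ((unitCube (Fin 2)).indicator (lift (u t))) y :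
        EuclideanSpace ℝ (Fin 2) →ₗ[ℝ] EuclideanSpace ℝ (Fin 2)) = 0 := by
  by_cases hyK : y ∈ K
  · have hy : y ∈ openSquare := hKsub hyK
    have h1 : IsContDiff 1 (u t) := (hsol.smooth_velocity.isSmooth_slice ht).isContDiff
      ENat.LEInfty.out
    rw [(cutoff_eventuallyEq_lift (u t) hy).fderiv_eq]
    exact (isDivFree_iff_trace_fderiv_lift h1).1 (hsol.divFree t ht) y
  · have hev : (unitCube (Fin 2)).indicator (lift (u t)) =ᶠ[𝓝 y]
        fun _ => (0 : EuclideanSpace ℝ (Fin 2)) :=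
      (eventually_cutoff_eq_zero hKc hK hyK).mono fun z hz => hz t ht
    rw [hev.fderiv_eq]
    simp

end Transfer


/-! ## The sup-norm scaling bounds (a) and (4.9)–(4.10) -/

section Bounds

variable {N : ℕ} {V : Fin N → ℝ → EuclideanSpace ℝ (Fin 2) → EuclideanSpace ℝ (Fin 2)}
  {Θ : Fin N → ℝ → EuclideanSpace ℝ (Fin 2) → ℝ} {ι : ℕ → (Fin 2 → ℤ) → Fin N}

/-- **The scaling arithmetic**: `mₙʲ / mₙ = 2^{j-1} 5^{(j-1)n}` for `mₙ = 2·5ⁿ`, written with the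
real power `5^{((j:ℝ)-1) n}` of `alberti_crippa_mazzucato_planar_family`. [folklore] -/
theorem mesh_pow_div (n j : ℕ) :
    (mesh n : ℝ) ^ j / (mesh n : ℝ) = 2 ^ j / 2 * (5 : ℝ) ^ (((j : ℝ) - 1) * n) := by
  have hrpow : (5 : ℝ) ^ (((j : ℝ) - 1) * n) = (5 ^ n) ^ j / 5 ^ n := by
    rw [show ((j : ℝ) - 1) * n = ((n * j : ℕ) : ℝ) - ((n : ℕ) : ℝ) by push_cast; ring,
      Real.rpow_sub (by norm_num : (0 : ℝ) < 5), Real.rpow_natCast, Real.rpow_natCast, pow_mul]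
  rw [hrpow, cast_mesh]
  have h5 : (5 : ℝ) ^ n ≠ 0 := by positivity
  field_simp
  ring

/-- **Sup-norm scaling bound for a time-derivative slice of a patched torus field** (ACM 2019,
Lemma 18, `p = ∞`; BDL Thm. 4.1 (a)/(4.10) at integer orders). Let `F` be a time-dependent torus
field which, for `s ∈ [0,1]`, is the level-`n` patch of the blocks `mₙ⁻¹ Φ_l(s, ·)` (blocks
jointly smooth on `[0,1] × ℝ²`), and whose slice `x ↦ ∂ₛᵏ F(·, x)(t)` is smooth on `T²`. If the
mixed derivatives `D_wⁱ ∂ₛᵏ Φ_l`, `i ≤ j`, are bounded by `B` on `[0,1] ×` the ball containing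
the fundamental square, then `‖Dʲ (lift ∂ₛᵏF(·,·)(t))(y)‖ ≤ 2^{j-1} 5^{(j-1)n} B` for every
`y ∈ ℝ²` (`Torus.norm_iteratedFDeriv_lift_patchTorus_le`: the time derivative acts blockwise,
so the slice is itself the patch of the blocks `mₙ⁻¹ ∂ₛᵏΦ_l(t, ·)`). [cite: AlbertiCrippaMazzucato2019, Lemma 18] -/
theorem norm_iteratedFDeriv_lift_slice_le {X : Type*} [NormedAddCommGroup X] [NormedSpace ℝ X]
    {Φ : Fin N → ℝ → EuclideanSpace ℝ (Fin 2) → X}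
    (hΦ : ∀ l, ContDiffOn ℝ ∞ (fun p : ℝ × EuclideanSpace ℝ (Fin 2) => Φ l p.1 p.2) (Icc 0 1 ×ˢ univ))
    {F : ℝ → UnitAddTorus (Fin 2) → X} (n : ℕ) {t : ℝ} (ht : t ∈ Icc (0 : ℝ) 1) {k j : ℕ}
    (hFs : IsSmooth fun x => iteratedDerivWithin k (fun s => F s x) (Icc 0 1) t)
    (hFeq : ∀ x, ∀ s ∈ Icc (0 : ℝ) 1,
      F s x = (mesh n : ℝ)⁻¹ • Φ (ι n (cellIndex (mesh n) (repr x))) s (cellCoord (mesh n) (repr x)))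
    {B : ℝ}
    (hB : ∀ i ≤ j, ∀ l, ∀ s ∈ Icc (0 : ℝ) 1,
      ∀ w ∈ closedBall (0 : EuclideanSpace ℝ (Fin 2)) (Fintype.card (Fin 2)),
        ‖iteratedFDeriv ℝ i (fun z => iteratedDerivWithin k (fun s' => Φ l s' z) (Icc 0 1) s) w‖ ≤ B)
    (y : EuclideanSpace ℝ (Fin 2)) :
    ‖iteratedFDeriv ℝ j (lift fun x => iteratedDerivWithin k (fun s => F s x) (Icc 0 1) t) y‖ ≤
      2 ^ j / 2 * (5 : ℝ) ^ (((j : ℝ) - 1) * n) * B := by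
  have hS : UniqueDiffOn ℝ (Icc (0 : ℝ) 1) := uniqueDiffOn_Icc zero_lt_one
  have hm := mesh_pos n
  have hm' : (0 : ℝ) < mesh n := by exact_mod_cast hm
  set G : Fin N → EuclideanSpace ℝ (Fin 2) → X :=
    fun l w => (mesh n : ℝ)⁻¹ • iteratedDerivWithin k (fun s => Φ l s w) (Icc 0 1) t with hGdef
  -- the slice is the patch of the blocks `G`
  have hFG : (fun x => iteratedDerivWithin k (fun s => F s x) (Icc 0 1) t) =
      patchTorus (mesh n) (ι n) G := by
    funext x
    rw [patchTorus_apply, patch_apply, hGdef]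
    dsimp only
    rw [iteratedDerivWithin_congr (f := fun s => F s x)
      (g := fun s => (mesh n : ℝ)⁻¹ • Φ (ι n (cellIndex (mesh n) (repr x))) s (cellCoord (mesh n) (repr x)))
      (fun s hs => hFeq x s hs) ht,
      show (fun s => (mesh n : ℝ)⁻¹ • Φ (ι n (cellIndex (mesh n) (repr x))) s (cellCoord (mesh n) (repr x))) =
        (mesh n : ℝ)⁻¹ • fun s => Φ (ι n (cellIndex (mesh n) (repr x))) s (cellCoord (mesh n) (repr x))
        from rfl, iteratedDerivWithin_const_smul_field]
  have hG1 : ∀ l, ContDiff ℝ ∞ fun w => iteratedDerivWithin k (fun s => Φ l s w) (Icc 0 1) t :=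
    fun l => (hΦ l).contDiff_iteratedDerivWithin_slice hS k ht
  have hG : ∀ l, ContDiff ℝ j (G l) := fun l =>
    ((hG1 l).const_smul ((mesh n : ℝ)⁻¹)).of_le ENat.LEInfty.out
  have hW : IsContDiff j (patchTorus (mesh n) (ι n) G) := by
    rw [← hFG]; exact hFs.isContDiff ENat.LEInfty.out
  have hM : ∀ i ≤ j, ∀ l, ∀ z ∈ unitCube (Fin 2),
      ‖iteratedFDeriv ℝ i (G l) z‖ ≤ (mesh n : ℝ)⁻¹ * B := by
    intro i hi l z hz
    have hz' := unitCube_subset_closedBall hz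
    rw [hGdef]
    dsimp only
    rw [iteratedFDeriv_const_smul_apply' (a := (mesh n : ℝ)⁻¹)
      (f := fun w => iteratedDerivWithin k (fun s => Φ l s w) (Icc 0 1) t)
      (((hG1 l).of_le ENat.LEInfty.out).contDiffAt),
      norm_smul, norm_inv, Real.norm_natCast]
    exact mul_le_mul_of_nonneg_left (hB i hi l t ht z hz') (inv_nonneg.2 hm'.le)
  have h := norm_iteratedFDeriv_lift_patchTorus_le hm hG hW (M := fun _ => (mesh n : ℝ)⁻¹ * B)
    hM le_rfl y
  rw [← hFG] at h
  refine h.trans (le_of_eq ?_)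
  rw [← mul_assoc, ← div_eq_mul_inv, mesh_pow_div]

/-- **(a) at integer orders for the cut-off velocity**: `‖Dʲ ∂ₜᵏ v_n(·,t)‖_∞ ≤ C(j,k) 5^{(j-1)n}`
uniformly in `n` (BDL Thm. 4.1 (a); ACM Lemma 18: `∂ₜᵏ v_n` is the patch of `mₙ⁻¹ ∂ₜᵏV_i`, the
finitely many blocks have bounded mixed derivatives on `[0,1] × [0,1]²`; near `K_n` the cut-off
is the lift, off `K_n` it vanishes). [cite: BrueDeLellisCMP2023, Thm. 4.1 (a)] -/
theorem norm_iteratedFDeriv_cutoff_velocity_le (hB : IsBuildingBlockFamily V Θ)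
    (hv : ∀ n, IsSmoothSpaceTimeOn (Icc 0 1) (velocity V ι n))
    {K : ℕ → Set (EuclideanSpace ℝ (Fin 2))} (hKc : ∀ n, IsClosed (K n))
    (hKsub : ∀ n, K n ⊆ openSquare)
    (hK : ∀ n, ∀ t ∈ Icc (0 : ℝ) 1, ∀ y ∈ unitCube (Fin 2), y ∉ K n →
      velocity V ι n t (proj y) = 0)
    (j k : ℕ) :
    ∃ C : ℝ, ∀ n : ℕ, ∀ t ∈ Icc (0 : ℝ) 1, ∀ y,
      ‖iteratedFDeriv ℝ j (fun z => iteratedDerivWithin k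
          (fun s => (unitCube (Fin 2)).indicator (lift (velocity V ι n s)) z) (Icc 0 1) t) y‖ ≤
        C * (5 : ℝ) ^ (((j : ℝ) - 1) * n) := by
  have hS : UniqueDiffOn ℝ (Icc (0 : ℝ) 1) := uniqueDiffOn_Icc zero_lt_one
  have hΦ : ∀ l, ContDiffOn ℝ ∞ (fun p : ℝ × EuclideanSpace ℝ (Fin 2) => V l p.1 p.2)
      (Icc 0 1 ×ˢ univ) := fun l => (hB.smooth_velocity l).contDiffOn
  choose B hB0 hBd using fun i l => exists_bound_iteratedFDeriv_iteratedDerivWithin (hΦ l)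
    (isCompact_closedBall (0 : EuclideanSpace ℝ (Fin 2)) (Fintype.card (Fin 2))) i k
  set Btot : ℝ := ∑ i ∈ Finset.range (j + 1), ∑ l, B i l with hBtot
  have hBtot0 : 0 ≤ Btot :=
    Finset.sum_nonneg fun i _ => Finset.sum_nonneg fun l _ => hB0 i l
  have hBle : ∀ i ≤ j, ∀ l, B i l ≤ Btot := fun i hi l =>
    (Finset.single_le_sum (fun l' _ => hB0 i l') (Finset.mem_univ l)).trans
      (Finset.single_le_sum (f := fun i => ∑ l, B i l)
        (fun i' _ => Finset.sum_nonneg fun l' _ => hB0 i' l') (Finset.mem_range.2 (Nat.lt_succ_of_le hi)))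
  refine ⟨2 ^ j * Btot, fun n t ht y => ?_⟩
  have h5 : (0 : ℝ) ≤ (5 : ℝ) ^ (((j : ℝ) - 1) * n) := by positivity
  by_cases hyK : y ∈ K n
  · have hy : y ∈ openSquare := hKsub n hyK
    -- near `y` the slice is the lift of the torus slice
    have hev : (fun z => iteratedDerivWithin k
          (fun s => (unitCube (Fin 2)).indicator (lift (velocity V ι n s)) z) (Icc 0 1) t)
        =ᶠ[𝓝 y] lift fun x => iteratedDerivWithin k (fun s => velocity V ι n s x) (Icc 0 1) t := by
      filter_upwards [eventually_cutoff_eq_lift (velocity V ι n) hy] with z hz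
      rw [lift_apply, iteratedDerivWithin_congr
        (f := fun s => (unitCube (Fin 2)).indicator (lift (velocity V ι n s)) z)
        (g := fun s => velocity V ι n s (proj z)) (fun s _ => by simp only [hz s, lift_apply]) ht]
    rw [(hev.iteratedFDeriv ℝ j).self_of_nhds]
    refine (norm_iteratedFDeriv_lift_slice_le hΦ n ht
      ((hv n).isSmooth_iteratedDerivWithin_slice hS k ht) (fun x s _ => velocity_eq V ι n s x)
      (fun i hi l s hs w hw => (hBd i l s hs w hw).trans (hBle i hi l)) y).trans ?_
    have hA : 2 ^ j / 2 * (5 : ℝ) ^ (((j : ℝ) - 1) * n) ≤ 2 ^ j * (5 : ℝ) ^ (((j : ℝ) - 1) * n) :=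
      mul_le_mul_of_nonneg_right (by linarith [pow_nonneg (zero_le_two (α := ℝ)) j]) h5
    calc 2 ^ j / 2 * (5 : ℝ) ^ (((j : ℝ) - 1) * n) * Btot
        ≤ 2 ^ j * (5 : ℝ) ^ (((j : ℝ) - 1) * n) * Btot := mul_le_mul_of_nonneg_right hA hBtot0
      _ = 2 ^ j * Btot * (5 : ℝ) ^ (((j : ℝ) - 1) * n) := by ring
  · rw [iteratedFDeriv_iteratedDerivWithin_eq_zero_of_local
      (eventually_cutoff_eq_zero (hKc n) (hK n) hyK) ht, norm_zero]
    positivity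

/-- **(4.9)–(4.10) at integer orders for the cut-off velocity**:
`‖Dʲ ∂ₜᵏ (v_n·∇v_n)(·,t)‖_∞ ≤ C(j,k) 5^{(j-1)n}` uniformly in `n` (BDL (4.9): the convective term
of the patched velocity is the patch of `mₙ⁻¹ DV_i[V_i]` — `QuasiSelfSimilar.fderiv_velocity` —
then as for (a)). [cite: BrueDeLellisCMP2023, (4.9)–(4.10)] -/
theorem norm_iteratedFDeriv_cutoff_convect_le (hB : IsBuildingBlockFamily V Θ)
    (hv : ∀ n, IsSmoothSpaceTimeOn (Icc 0 1) (velocity V ι n))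
    {K : ℕ → Set (EuclideanSpace ℝ (Fin 2))} (hKc : ∀ n, IsClosed (K n))
    (hKsub : ∀ n, K n ⊆ openSquare)
    (hK : ∀ n, ∀ t ∈ Icc (0 : ℝ) 1, ∀ y ∈ unitCube (Fin 2), y ∉ K n →
      velocity V ι n t (proj y) = 0)
    (j k : ℕ) :
    ∃ C : ℝ, ∀ n : ℕ, ∀ t ∈ Icc (0 : ℝ) 1, ∀ y,
      ‖iteratedFDeriv ℝ j (fun z => iteratedDerivWithin k
          (fun s => fderiv ℝ ((unitCube (Fin 2)).indicator (lift (velocity V ι n s))) z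
            ((unitCube (Fin 2)).indicator (lift (velocity V ι n s)) z)) (Icc 0 1) t) y‖ ≤
        C * (5 : ℝ) ^ (((j : ℝ) - 1) * n) := by
  have hS : UniqueDiffOn ℝ (Icc (0 : ℝ) 1) := uniqueDiffOn_Icc zero_lt_one
  -- the convective blocks `W_l(s, w) = DV_l(s,·)(w)[V_l(s, w)]`, jointly smooth on `[0,1] × ℝ²`
  set W : Fin N → ℝ → EuclideanSpace ℝ (Fin 2) → EuclideanSpace ℝ (Fin 2) :=
    fun l s w => fderiv ℝ (V l s) w (V l s w) with hW
  have hΦ : ∀ l, ContDiffOn ℝ ∞ (fun p : ℝ × EuclideanSpace ℝ (Fin 2) => W l p.1 p.2)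
      (Icc 0 1 ×ˢ univ) := fun l =>
    ((hB.smooth_velocity l).contDiffOn (s := Icc 0 1 ×ˢ univ)).contDiffOn_convect_slice hS
  choose B hB0 hBd using fun i l => exists_bound_iteratedFDeriv_iteratedDerivWithin (hΦ l)
    (isCompact_closedBall (0 : EuclideanSpace ℝ (Fin 2)) (Fintype.card (Fin 2))) i k
  set Btot : ℝ := ∑ i ∈ Finset.range (j + 1), ∑ l, B i l with hBtot
  have hBtot0 : 0 ≤ Btot :=
    Finset.sum_nonneg fun i _ => Finset.sum_nonneg fun l _ => hB0 i l
  have hBle : ∀ i ≤ j, ∀ l, B i l ≤ Btot := fun i hi l =>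
    (Finset.single_le_sum (fun l' _ => hB0 i l') (Finset.mem_univ l)).trans
      (Finset.single_le_sum (f := fun i => ∑ l, B i l)
        (fun i' _ => Finset.sum_nonneg fun l' _ => hB0 i' l') (Finset.mem_range.2 (Nat.lt_succ_of_le hi)))
  refine ⟨2 ^ j * Btot, fun n t ht y => ?_⟩
  have hm : (mesh n : ℝ) ≠ 0 := by exact_mod_cast (mesh_pos n).ne'
  have h5 : (0 : ℝ) ≤ (5 : ℝ) ^ (((j : ℝ) - 1) * n) := by positivity
  -- the torus convective field and its blockwise form (BDL (4.9))
  have hF : IsSmoothSpaceTimeOn (Icc 0 1)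
      (fun s => Torus.convect (velocity V ι n s) (velocity V ι n s)) := (hv n).convect (hv n) hS
  have hFeq : ∀ x, ∀ s ∈ Icc (0 : ℝ) 1,
      Torus.convect (velocity V ι n s) (velocity V ι n s) x =
        (mesh n : ℝ)⁻¹ • W (ι n (cellIndex (mesh n) (repr x))) s (cellCoord (mesh n) (repr x)) := by
    intro x s hs
    rw [Torus.convect, fderiv_velocity hB ((hv n).isSmooth_slice hs) x, velocity_eq, map_smul]
  by_cases hyK : y ∈ K n
  · have hy : y ∈ openSquare := hKsub n hyK
    -- near `y` the planar convective term is the lift of the torus one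
    have hev : (fun z => iteratedDerivWithin k
        (fun s => fderiv ℝ ((unitCube (Fin 2)).indicator (lift (velocity V ι n s))) z
          ((unitCube (Fin 2)).indicator (lift (velocity V ι n s)) z)) (Icc 0 1) t)
        =ᶠ[𝓝 y] lift fun x => iteratedDerivWithin k
          (fun s => Torus.convect (velocity V ι n s) (velocity V ι n s) x) (Icc 0 1) t := by
      filter_upwards [isOpen_openSquare.mem_nhds hy] with z hz
      rw [lift_apply]
      refine iteratedDerivWithin_congr (f := fun s =>
        fderiv ℝ ((unitCube (Fin 2)).indicator (lift (velocity V ι n s))) z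
          ((unitCube (Fin 2)).indicator (lift (velocity V ι n s)) z)) (fun s _ => ?_) ht
      dsimp only
      rw [(cutoff_eventuallyEq_lift (velocity V ι n s) hz).fderiv_eq, fderiv_lift,
        cutoff_apply_of_mem _ (openSquare_subset_unitCube hz), Torus.convect]
    rw [(hev.iteratedFDeriv ℝ j).self_of_nhds]
    refine (norm_iteratedFDeriv_lift_slice_le hΦ n ht (hF.isSmooth_iteratedDerivWithin_slice hS k ht)
      hFeq (fun i hi l s hs w hw => (hBd i l s hs w hw).trans (hBle i hi l)) y).trans ?_
    have hA : 2 ^ j / 2 * (5 : ℝ) ^ (((j : ℝ) - 1) * n) ≤ 2 ^ j * (5 : ℝ) ^ (((j : ℝ) - 1) * n) :=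
      mul_le_mul_of_nonneg_right (by linarith [pow_nonneg (zero_le_two (α := ℝ)) j]) h5
    calc 2 ^ j / 2 * (5 : ℝ) ^ (((j : ℝ) - 1) * n) * Btot
        ≤ 2 ^ j * (5 : ℝ) ^ (((j : ℝ) - 1) * n) * Btot := mul_le_mul_of_nonneg_right hA hBtot0
      _ = 2 ^ j * Btot * (5 : ℝ) ^ (((j : ℝ) - 1) * n) := by ring
  · have hzero : ∀ᶠ z in 𝓝 y, ∀ s ∈ Icc (0 : ℝ) 1,
        fderiv ℝ ((unitCube (Fin 2)).indicator (lift (velocity V ι n s))) z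
          ((unitCube (Fin 2)).indicator (lift (velocity V ι n s)) z) = 0 := by
      filter_upwards [eventually_eventually_nhds.2 (eventually_cutoff_eq_zero (hKc n) (hK n) hyK)]
        with z hz s hs
      have hz' : (unitCube (Fin 2)).indicator (lift (velocity V ι n s)) =ᶠ[𝓝 z]
          fun _ => (0 : EuclideanSpace ℝ (Fin 2)) :=
        hz.mono fun w hw => hw s hs
      rw [hz'.fderiv_eq]
      simp
    rw [iteratedFDeriv_iteratedDerivWithin_eq_zero_of_local hzero ht, norm_zero]
    positivity

end Bounds

/-! ## Item (b), the cell structure, and the gradient bound for the cut-off scalar -/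

section ItemB

variable {N : ℕ} {V : Fin N → ℝ → EuclideanSpace ℝ (Fin 2) → EuclideanSpace ℝ (Fin 2)}
  {Θ : Fin N → ℝ → EuclideanSpace ℝ (Fin 2) → ℝ} {ι : ℕ → (Fin 2 → ℤ) → Fin N}

/-- `∫_{ℝ²} ρ_n(t) = ∫_{T²} ρ_n(t) = 0` for the cut-off scalar (BDL Thm. 4.1 (b)).
[cite: BrueDeLellisCMP2023, Thm. 4.1 (b)] -/
theorem integral_cutoff_scalar (hB : IsBuildingBlockFamily V Θ) (n : ℕ) {t : ℝ}
    (ht : t ∈ Icc (0 : ℝ) 1) : ∫ y, (unitCube (Fin 2)).indicator (lift (scalar Θ ι n t)) y = 0 := by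
  rw [integral_indicator measurableSet_unitCube, ← integral_eq_integral_lift_holds]
  exact integral_scalar hB n ht

/-- `∫_{ℝ²} ρ_n(t)² = ∫_{T²} ρ_n(t)² = 1` for the cut-off scalar (BDL Thm. 4.1 (b)).
[cite: BrueDeLellisCMP2023, Thm. 4.1 (b)] -/
theorem integral_cutoff_scalar_sq (hB : IsBuildingBlockFamily V Θ) (n : ℕ) {t : ℝ}
    (ht : t ∈ Icc (0 : ℝ) 1) : ∫ y, (unitCube (Fin 2)).indicator (lift (scalar Θ ι n t)) y ^ 2 = 1 := by
  have h : (fun y => (unitCube (Fin 2)).indicator (lift (scalar Θ ι n t)) y ^ 2) =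
      (unitCube (Fin 2)).indicator (lift (fun x => scalar Θ ι n t x ^ 2)) := by
    funext y
    by_cases hy : y ∈ unitCube (Fin 2)
    · rw [cutoff_apply_of_mem _ hy, cutoff_apply_of_mem _ hy]
    · rw [cutoff_apply_of_not_mem _ hy, cutoff_apply_of_not_mem _ hy, zero_pow two_ne_zero]
  rw [h, integral_indicator measurableSet_unitCube, ← integral_eq_integral_lift_holds]
  exact integral_scalar_sq hB n ht

/-- `|ρ_n(t, y)| ≤ 10` for the cut-off scalar (BDL Thm. 4.1 (b)). [cite: BrueDeLellisCMP2023, Thm. 4.1 (b)] -/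
theorem abs_cutoff_scalar_le (hB : IsBuildingBlockFamily V Θ) (n : ℕ) {t : ℝ}
    (ht : t ∈ Icc (0 : ℝ) 1) (y : EuclideanSpace ℝ (Fin 2)) :
    |(unitCube (Fin 2)).indicator (lift (scalar Θ ι n t)) y| ≤ 10 := by
  by_cases hy : y ∈ unitCube (Fin 2)
  · rw [cutoff_apply_of_mem _ hy]; exact abs_scalar_le hB n ht _
  · rw [cutoff_apply_of_not_mem _ hy]; norm_num

/-- **(4.3) + (ii): zero averages on all cells of `𝒬(2·5ⁿ)`** for the cut-off scalar: on a
cell of the fundamental square this is the vanishing cell average of the torus scalar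
(`setIntegral_latticeCell_scalar`), and cells outside the fundamental square carry zero.
[cite: BrueDeLellisCMP2023, Thm. 4.1 (4.3) and §4.1 (ii)] -/
theorem setIntegral_latticeCell_cutoff_scalar (hB : IsBuildingBlockFamily V Θ) (n : ℕ) {t : ℝ}
    (ht : t ∈ Icc (0 : ℝ) 1) (m : Fin 2 → ℤ) :
    ∫ y in latticeCell (mesh n) m, (unitCube (Fin 2)).indicator (lift (scalar Θ ι n t)) y = 0 := by
  have hm := mesh_pos n
  by_cases hr : ∀ i, 0 ≤ m i ∧ m i < mesh n
  · -- a cell of the fundamental square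
    obtain ⟨κ, rfl⟩ : ∃ κ : Fin 2 → Fin (mesh n), m = fun i => ((κ i : ℕ) : ℤ) := by
      refine ⟨fun i => ⟨(m i).toNat, ?_⟩, funext fun i => ?_⟩
      · have := hr i; omega
      · have := hr i; simp only; omega
    rw [setIntegral_congr_fun measurableSet_latticeCell (g := fun y => scalar Θ ι n t (proj y))
      (fun y hy => cutoff_apply_of_mem _ (latticeCell_subset_unitCube hm κ hy))]
    exact setIntegral_latticeCell_scalar hB n ht κ
  · -- a cell outside the fundamental square: the cut-off vanishes on it
    refine setIntegral_eq_zero_of_forall_eq_zero fun y hy => cutoff_apply_of_not_mem _ fun hyc => hr ?_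
    intro i
    have h := cellIndex_nonneg_lt_of_mem_unitCube hm hyc i
    rwa [cellIndex_of_mem_latticeCell hm hy] at h

/-- **The gradient bound** `‖∇ρ_n(t)(y)‖ ≤ 2B · 5ⁿ` for the cut-off scalar (BDL Thm. 4.1 (b):
`≤ C 5ⁿ`; near `K_n`: `∇(lift ρ_n(t))(y) = ∇ρ_n(t)(proj y)` and
`QuasiSelfSimilar.exists_norm_gradient_scalar_le`; off `K_n` the cut-off vanishes).
[cite: BrueDeLellisCMP2023, Thm. 4.1 (b)] -/
theorem norm_gradient_cutoff_scalar_le (hB : IsBuildingBlockFamily V Θ)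
    (hs : ∀ n, IsSmoothSpaceTimeOn (Icc 0 1) (scalar Θ ι n))
    {K : ℕ → Set (EuclideanSpace ℝ (Fin 2))} (hKc : ∀ n, IsClosed (K n))
    (hKsub : ∀ n, K n ⊆ openSquare)
    (hK : ∀ n, ∀ t ∈ Icc (0 : ℝ) 1, ∀ y ∈ unitCube (Fin 2), y ∉ K n → scalar Θ ι n t (proj y) = 0) :
    ∃ C : ℝ, ∀ n : ℕ, ∀ t ∈ Icc (0 : ℝ) 1, ∀ y,
      ‖gradient ((unitCube (Fin 2)).indicator (lift (scalar Θ ι n t))) y‖ ≤ C * 5 ^ n := by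
  obtain ⟨B, hB0, hBd⟩ := exists_norm_gradient_scalar_le (ι := ι) hB hs
  refine ⟨2 * B, fun n t ht y => ?_⟩
  by_cases hyK : y ∈ K n
  · rw [(cutoff_eventuallyEq_lift (scalar Θ ι n t) (hKsub n hyK)).gradient_eq, gradient_lift]
    calc ‖Torus.gradient (scalar Θ ι n t) (proj y)‖ ≤ B * (2 * 5 ^ n) := hBd n t ht _
      _ = 2 * B * 5 ^ n := by ring
  · have hev : (unitCube (Fin 2)).indicator (lift (scalar Θ ι n t)) =ᶠ[𝓝 y] fun _ => (0 : ℝ) :=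
      (eventually_cutoff_eq_zero (hKc n) (hK n) hyK).mono fun z hz => hz t ht
    rw [hev.gradient_eq]
    simp only [gradient_fun_const, norm_zero]
    positivity

end ItemB

end QuasiSelfSimilar

open QuasiSelfSimilar FunctionSpaces FunctionSpaces.Torus in
/-- **Bruè–De Lellis 2023, Thm. 4.1 in the plane, from the building blocks.** The structural
fact `acm_building_blocks` (ACM 2019 building blocks with BDL §4.1 (i)–(iv), labels for which the
patched torus fields (4.3)–(4.4) are jointly smooth, supported per level in a compact of the
open fundamental square, and hand over) yields the planar quasi-self-similar family of
`alberti_crippa_mazzucato_planar_family`: the witnesses are the cube cut-offs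
`𝟙_{[0,1)²} ρ_n ∘ proj`, `𝟙_{[0,1)²} v_n ∘ proj` of the torus family — smooth on `[0,1] × ℝ²`,
supported in `K_n ⋐ (0,1)²`, transport + incompressibility, (a) and (4.9)–(4.10) at integer
orders by the scaling analysis (ACM Lemma 18), item (b), zero averages on the cells of
`𝒬(2·5ⁿ)`, handover (d). [cite: BrueDeLellisCMP2023, Thm. 4.1 with (4.3)–(4.4) and (4.9)–(4.10)] [cite: AlbertiCrippaMazzucato2019, §6.2, Lemma 18] -/
theorem alberti_crippa_mazzucato_planar_family_of_acm_building_blocks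
    (h : acm_building_blocks) : alberti_crippa_mazzucato_planar_family := by
  obtain ⟨N, V, Θ, ι, hB, hsm, hK, hd⟩ := h
  choose K hKc hKsub hK0 using hK
  have hKcl : ∀ n, IsClosed (K n) := fun n => (hKc n).isClosed
  have hv0 : ∀ n, ∀ t ∈ Icc (0 : ℝ) 1, ∀ y ∈ unitCube (Fin 2), y ∉ K n →
      velocity V ι n t (proj y) = 0 := fun n t ht y hy hyK => (hK0 n t ht y hy hyK).1
  have hρ0 : ∀ n, ∀ t ∈ Icc (0 : ℝ) 1, ∀ y ∈ unitCube (Fin 2), y ∉ K n →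
      scalar Θ ι n t (proj y) = 0 := fun n t ht y hy hyK => (hK0 n t ht y hy hyK).2
  have hsol : ∀ n, Torus.IsClassicalScalarTransportOn (Icc 0 1) 0 (velocity V ι n) (scalar Θ ι n) :=
    fun n => isClassicalScalarTransportOn hB (hsm n).1 (hsm n).2
  refine ⟨fun n t => (unitCube (Fin 2)).indicator (lift (scalar Θ ι n t)),
    fun n t => (unitCube (Fin 2)).indicator (lift (velocity V ι n t)),
    fun n => ⟨contDiffOn_cutoff (hsm n).1 (hKcl n) (hKsub n) (hρ0 n),
      contDiffOn_cutoff (hsm n).2 (hKcl n) (hKsub n) (hv0 n)⟩,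
    fun n => ⟨K n, hKc n, hKsub n, fun t ht y hy =>
      ⟨cutoff_eq_zero_of_not_mem (hρ0 n t ht) hy, cutoff_eq_zero_of_not_mem (hv0 n t ht) hy⟩⟩,
    fun n t ht y => ⟨transport_cutoff (hsol n) (hKcl n) (hKsub n) (hρ0 n) ht y,
      trace_fderiv_cutoff (hsol n) (hKcl n) (hKsub n) (hv0 n) ht y⟩,
    norm_iteratedFDeriv_cutoff_velocity_le hB (fun n => (hsm n).2) hKcl hKsub hv0,
    norm_iteratedFDeriv_cutoff_convect_le hB (fun n => (hsm n).2) hKcl hKsub hv0,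
    fun n t ht => ⟨integral_cutoff_scalar hB n ht, integral_cutoff_scalar_sq hB n ht,
      fun y => abs_cutoff_scalar_le hB n ht y⟩,
    norm_gradient_cutoff_scalar_le hB (fun n => (hsm n).1) hKcl hKsub hρ0,
    fun n t ht m => ?_, fun n => ?_⟩
  · -- zero averages on the cells `{y | 2·5ⁿ y - m ∈ [0,1)²} = Q_m`
    have hset : {y : EuclideanSpace ℝ (Fin 2) |
        ((2 * 5 ^ n : ℕ) : ℝ) • y - latticeVec m ∈ unitCube (Fin 2)} = latticeCell (mesh n) m :=
      Set.ext fun y => (mem_latticeCell_iff_smul_sub_mem_unitCube (mesh_pos n) m y).symm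
    rw [hset]
    exact setIntegral_latticeCell_cutoff_scalar hB n ht m
  · -- handover
    funext y
    show (unitCube (Fin 2)).indicator (lift (scalar Θ ι n 1)) y =
      (unitCube (Fin 2)).indicator (lift (scalar Θ ι (n + 1) 0)) y
    rw [hd n]

end Literature.Analysis.FluidPDE

end
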